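import Literature.RingTheory.Henselian.FiniteFlatHopfAlgebraLocalFactors
import Literature.RingTheory.Henselian.FiniteFlatHopfAlgebraUnitFactor
import Literature.RingTheory.Henselian.FiniteFlatHopfAlgebraTranslations
import HarnessLib

/-!
# The unit factor `Localization.AtPrime 𝔫_ε` of a finite commutative bialgebra over a henselian local ring: descended
# comultiplication and counit, kernel of the reduction map on points ([Tate1997FiniteFlatGroupSchemes] (3.7) (I))

Topic `Literature/RingTheory/Henselian`; namespace `Literature.RingTheory.Henselian`.  PROOF FILE (theorems only; no definition,
no named fact, no instance, no notation, no `sorry`).  Cell `hodgecm-mathlib` (D-0151), FLOOR-0 P5a row G3, file (B4) = the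
LOCAL-FACTOR-currency reading of ★ (B2) `FiniteFlatHopfAlgebraUnitFactor` (corner `B ⧸ (1 - e)`) through ★ (B1)
`FiniteFlatHopfAlgebraLocalFactors` (`B ⧸ (1 - e) ≃ₐ[R] Localization.AtPrime 𝔫`, `θ ∘ mk = algebraMap`) and ★ (B3)
`FiniteFlatHopfAlgebraTranslations` (`residue ∘ φ = residue ∘ ψ ⇔ 𝔫_φ = 𝔫_ψ`), as asked by F0P5a-plan (g5) 06:49:19Z (1)
heads (d)(e): `𝔫_ε := RingHom.ker ((IsLocalRing.residue R).comp (Bialgebra.counitAlgHom R B))` spelled out, no abbreviation,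
no `Bialgebra` instance on the local factor.

* `exists_unit_idempotent` (`R` henselian, `B` module-finite): the separating idempotent at `𝔫_ε` exists (★ (B1)).
* `apply_eq_one_iff_ker_eq` (`R` local): for the unit idempotent `e` and an `R`-point `φ`, `φ e = 1 ⟺ 𝔫_φ = 𝔫_ε`.
* **`existsUnique_counit_localization`** (`R` local): `∃! ε_L : B_{𝔫_ε} →ₐ[R] R`, `ε_L ∘ algebraMap = ε`.
* **`existsUnique_comul_localization`** (`R` henselian, `B` module-finite): `∃! Δ_L : B_{𝔫_ε} →ₐ[R] B_{𝔫_ε} ⊗[R] B_{𝔫_ε}`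
  with `Δ_L ∘ algebraMap = (algebraMap ⊗ algebraMap) ∘ Δ` — «`G⁰ G⁰ = G⁰`» for the unit local factor (transport of ★ (B2)
  `existsUnique_comul_unitCorner` along ★ (B1) `exists_algEquiv_quotient_localization`; uniqueness by ★ (B1)
  `algHom_localization_ext`).  The co-laws hold for the transported pair by ★ (B2) `map_counit_id_comp_comul_unitCorner`,
  `map_id_counit_comp_comul_unitCorner`, `coassoc_comul_unitCorner` read through `θ` (not re-derived here).
* **`exists_algHom_localization_counit_comp_eq_iff`** (`R` local; head (e), no idempotent in the statement): an `R`-point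
  `φ` factors through the unit factor `B_{𝔫_ε}` IFF its reduction is the unit point, `residue ∘ φ = residue ∘ ε` — i.e.
  «`ker (G(R) → G(k)) = G⁰(R)`» (with ★ (B3) `comp_convMul_points` the reduction is multiplicative).

HC_CM is proved only modulo the 7 printed citations until rung 0 closes; this file is generic algebra and changes no count.

## References
* [Tate1997FiniteFlatGroupSchemes] J. Tate, *Finite flat group schemes*, in: Cornell–Silverman–Stevens (eds.), *Modular Forms and
  Fermat's Last Theorem* (Springer 1997), (3.7) (I).
* [StacksProject] The Stacks Project, Tags 04GG, 04GH.
-/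

set_option autoImplicit false

noncomputable section

universe u v

open IsLocalRing TensorProduct

namespace Literature.RingTheory.Henselian

section UnitFactorLocalization

variable {R : Type u} [CommRing R] [IsLocalRing R]
variable {B : Type v} [CommRing B] [Bialgebra R B]

/-- **Existence of the unit idempotent over a henselian base.**  For `B` module-finite over a HENSELIAN local ring there
is an idempotent `e ∈ B` with `e ≡ 1 (mod 𝔫₁)` and `e ∈ 𝔫` for every other maximal ideal `𝔫` (the member at `𝔫₁` of
the separating family ★ `Henselian.exists_completeOrthogonalIdempotents_maximalSpectrum`). [cite: StacksProject, Tag 04GG (1)⇒(10)] -/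
theorem exists_unit_idempotent {R : Type u} [CommRing R] [HenselianLocalRing R] {B : Type v} [CommRing B]
    [Bialgebra R B] [Module.Finite R B] :
    ∃ e : B, IsIdempotentElem e ∧ e - 1 ∈ RingHom.ker ((residue R).comp (Bialgebra.counitAlgHom R B : B →+* R)) ∧
      ∀ 𝔫 : Ideal B, 𝔫.IsMaximal → 𝔫 ≠ RingHom.ker ((residue R).comp (Bialgebra.counitAlgHom R B : B →+* R)) →
        e ∈ 𝔫 := by
  haveI := (Literature.RingTheory.Idempotents.isMaximal_ker_residue_comp (Bialgebra.counitAlgHom R B)).1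
  exact exists_separatingIdempotent (R := R) _


/-- **Kernel of the reduction map on `R`-points = points of the unit corner.**  For an `R`-point `g : B →ₐ[R] R` of
`G = Spec B` the following are equivalent: (a) `g(e) = 1`; (b) the reduction of `g` is the unit point, i.e. the maximal
ideal `ker(B →g R → k)` equals `𝔫₁`; and then `g` factors (uniquely) through the unit corner `B ⧸ (1 - e)`.  Here (a)⇔(b).
[cite: Tate1997FiniteFlatGroupSchemes, (3.7) (I)] [cite: StacksProject, Tag 04GG] -/
theorem apply_eq_one_iff_ker_eq {e : B} (he : IsIdempotentElem e)
    (he1 : e - 1 ∈ RingHom.ker ((residue R).comp (Bialgebra.counitAlgHom R B : B →+* R)))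
    (he0 : ∀ 𝔫 : Ideal B, 𝔫.IsMaximal → 𝔫 ≠ RingHom.ker ((residue R).comp (Bialgebra.counitAlgHom R B : B →+* R)) →
      e ∈ 𝔫) (g : B →ₐ[R] R) :
    g e = 1 ↔ RingHom.ker ((residue R).comp (g : B →+* R)) =
      RingHom.ker ((residue R).comp (Bialgebra.counitAlgHom R B : B →+* R)) := by
  have hsurj : Function.Surjective ((residue R).comp (g : B →+* R)) := fun r => by
    obtain ⟨s, rfl⟩ := residue_surjective r
    exact ⟨algebraMap R B s, by simp⟩
  have hmax : (RingHom.ker ((residue R).comp (g : B →+* R))).IsMaximal := RingHom.ker_isMaximal_of_surjective _ hsurj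
  have hidem : IsIdempotentElem (g e) := he.map g
  constructor
  · intro hge
    by_contra hne
    have hmem : e ∈ RingHom.ker ((residue R).comp (g : B →+* R)) := he0 _ hmax hne
    rw [RingHom.mem_ker, RingHom.comp_apply] at hmem
    have : g e ∈ maximalIdeal R := (IsLocalRing.residue_eq_zero_iff _).1 hmem
    rw [hge] at this
    exact (IsLocalRing.maximalIdeal.isMaximal R).ne_top ((Ideal.eq_top_iff_one _).2 this)
  · intro heq
    have hmem : e - 1 ∈ RingHom.ker ((residue R).comp (g : B →+* R)) := heq ▸ he1
    -- `g e` is an idempotent of `R` congruent to `1`, hence `1`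
    have hmem' : g e - 1 ∈ maximalIdeal R := by
      rw [RingHom.mem_ker, RingHom.comp_apply] at hmem
      simpa using (IsLocalRing.residue_eq_zero_iff _).1 hmem
    have hunit : IsUnit (g e) := by
      by_contra h
      have h' : g e ∈ maximalIdeal R := h
      have h1 : (1 : R) ∈ maximalIdeal R := by
        have := (maximalIdeal R).sub_mem h' hmem'
        rwa [sub_sub_cancel] at this
      exact (IsLocalRing.maximalIdeal.isMaximal R).ne_top ((Ideal.eq_top_iff_one _).2 h1)
    exact hunit.mul_left_cancel (by rw [mul_one]; exact hidem.eq)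

/-- **The counit descends uniquely to the unit local factor** `Localization.AtPrime 𝔫_ε` (any local `R`).
[cite: Tate1997FiniteFlatGroupSchemes, (3.7) (I)] -/
theorem existsUnique_counit_localization :
    haveI := (Literature.RingTheory.Idempotents.isMaximal_ker_residue_comp (Bialgebra.counitAlgHom R B)).1
    ∃! εL : Localization.AtPrime (RingHom.ker ((residue R).comp (Bialgebra.counitAlgHom R B : B →+* R))) →ₐ[R] R,
      εL.comp (IsScalarTower.toAlgHom R B _) = Bialgebra.counitAlgHom R B := by
  haveI := (Literature.RingTheory.Idempotents.isMaximal_ker_residue_comp (Bialgebra.counitAlgHom R B)).1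
  obtain ⟨εL, hεL⟩ := (exists_algHom_localization_comp_eq_iff_eq (R := R)
    (RingHom.ker ((residue R).comp (Bialgebra.counitAlgHom R B : B →+* R))) (Bialgebra.counitAlgHom R B)).2 rfl
  exact ⟨εL, hεL, fun ε' hε' => algHom_localization_ext _ _ _ (hε'.trans hεL.symm)⟩

/-- **Kernel of the reduction map = points of the unit factor** (head (e), idempotent-free statement; stated for a Hopf
algebra to match ★ (B3) `residue_comp_eq_iff_ker_eq`): an `R`-point `φ : B →ₐ[R] R` factors through the unit local factor
`Localization.AtPrime 𝔫_ε` IFF its reduction is the unit point, `residue ∘ φ = residue ∘ ε`.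
[cite: Tate1997FiniteFlatGroupSchemes, (3.7) (I)] -/
theorem exists_algHom_localization_counit_comp_eq_iff {R : Type u} [CommRing R] [IsLocalRing R] {B : Type v} [CommRing B]
    [HopfAlgebra R B] (φ : B →ₐ[R] R) :
    haveI := (Literature.RingTheory.Idempotents.isMaximal_ker_residue_comp (Bialgebra.counitAlgHom R B)).1
    (∃ ψ : Localization.AtPrime (RingHom.ker ((residue R).comp (Bialgebra.counitAlgHom R B : B →+* R))) →ₐ[R] R,
        ψ.comp (IsScalarTower.toAlgHom R B _) = φ) ↔
      (residue R).comp (φ : B →+* R) = (residue R).comp (Bialgebra.counitAlgHom R B : B →+* R) := by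
  haveI := (Literature.RingTheory.Idempotents.isMaximal_ker_residue_comp (Bialgebra.counitAlgHom R B)).1
  rw [exists_algHom_localization_comp_eq_iff_eq, residue_comp_eq_iff_ker_eq, eq_comm]

/-- `φ e = 1` form of the same criterion (unit idempotent `e`). [cite: Tate1997FiniteFlatGroupSchemes, (3.7) (I)] -/
theorem exists_algHom_localization_counit_comp_eq_iff_apply_eq_one {e : B} (he : IsIdempotentElem e)
    (he1 : e - 1 ∈ RingHom.ker ((residue R).comp (Bialgebra.counitAlgHom R B : B →+* R)))
    (he0 : ∀ 𝔫 : Ideal B, 𝔫.IsMaximal → 𝔫 ≠ RingHom.ker ((residue R).comp (Bialgebra.counitAlgHom R B : B →+* R)) →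
      e ∈ 𝔫) (φ : B →ₐ[R] R) :
    haveI := (Literature.RingTheory.Idempotents.isMaximal_ker_residue_comp (Bialgebra.counitAlgHom R B)).1
    (∃ ψ : Localization.AtPrime (RingHom.ker ((residue R).comp (Bialgebra.counitAlgHom R B : B →+* R))) →ₐ[R] R,
        ψ.comp (IsScalarTower.toAlgHom R B _) = φ) ↔ φ e = 1 := by
  haveI := (Literature.RingTheory.Idempotents.isMaximal_ker_residue_comp (Bialgebra.counitAlgHom R B)).1
  rw [exists_algHom_localization_comp_eq_iff_eq, apply_eq_one_iff_ker_eq he he1 he0, eq_comm]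

/-- **The comultiplication descends uniquely to the unit local factor** (`R` henselian, `B` module-finite): there is a unique
`Δ_L : B_{𝔫_ε} → B_{𝔫_ε} ⊗ B_{𝔫_ε}` with `Δ_L ∘ algebraMap = (algebraMap ⊗ algebraMap) ∘ Δ` — «`G⁰ G⁰ = G⁰`» (★ (B2)
`existsUnique_comul_unitCorner` transported along ★ (B1) `exists_algEquiv_quotient_localization`).
[cite: Tate1997FiniteFlatGroupSchemes, (3.7) (I)] -/
theorem existsUnique_comul_localization {R : Type u} [CommRing R] [HenselianLocalRing R] {B : Type v} [CommRing B]
    [Bialgebra R B] [Module.Finite R B] :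
    haveI := (Literature.RingTheory.Idempotents.isMaximal_ker_residue_comp (Bialgebra.counitAlgHom R B)).1
    ∃! ΔL : Localization.AtPrime (RingHom.ker ((residue R).comp (Bialgebra.counitAlgHom R B : B →+* R))) →ₐ[R]
        Localization.AtPrime (RingHom.ker ((residue R).comp (Bialgebra.counitAlgHom R B : B →+* R))) ⊗[R]
          Localization.AtPrime (RingHom.ker ((residue R).comp (Bialgebra.counitAlgHom R B : B →+* R))),
      ΔL.comp (IsScalarTower.toAlgHom R B _) =
        (Algebra.TensorProduct.map (IsScalarTower.toAlgHom R B _) (IsScalarTower.toAlgHom R B _)).comp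
          (Bialgebra.comulAlgHom R B) := by
  haveI h𝔫 := (Literature.RingTheory.Idempotents.isMaximal_ker_residue_comp (Bialgebra.counitAlgHom R B)).1
  obtain ⟨e, he, he1, he0⟩ := exists_unit_idempotent (R := R) (B := B)
  obtain ⟨θ, hθ⟩ := exists_algEquiv_quotient_localization (R := R)
    (RingHom.ker ((residue R).comp (Bialgebra.counitAlgHom R B : B →+* R))) he he1 he0
  obtain ⟨Δ₀, hΔ₀, -⟩ := existsUnique_comul_unitCorner (R := R) he he1 he0
  -- `θ ∘ mk = algebraMap`
  have hθmk : θ.toAlgHom.comp (Ideal.Quotient.mkₐ R (Ideal.span {1 - e})) =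
      IsScalarTower.toAlgHom R B _ := AlgHom.ext fun b => by
    rw [AlgHom.comp_apply, IsScalarTower.coe_toAlgHom', Ideal.Quotient.mkₐ_eq_mk, AlgEquiv.coe_toAlgHom]
    exact hθ b
  have hΔ₀b : ∀ b : B, Δ₀ (Ideal.Quotient.mk (Ideal.span {1 - e}) b) =
      Algebra.TensorProduct.map (Ideal.Quotient.mkₐ R (Ideal.span {1 - e})) (Ideal.Quotient.mkₐ R (Ideal.span {1 - e}))
        (Coalgebra.comul (R := R) b) := fun b => by
    have := congrArg (fun φ => φ b) hΔ₀
    simpa [AlgHom.comp_apply] using this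
  have key : ((Algebra.TensorProduct.map θ.toAlgHom θ.toAlgHom).comp (Δ₀.comp θ.symm.toAlgHom)).comp
      (IsScalarTower.toAlgHom R B _) =
      (Algebra.TensorProduct.map (IsScalarTower.toAlgHom R B _) (IsScalarTower.toAlgHom R B _)).comp
        (Bialgebra.comulAlgHom R B) := by
    apply AlgHom.ext
    intro b
    rw [← hθmk, Algebra.TensorProduct.map_comp]
    simp only [AlgHom.comp_apply, AlgEquiv.coe_toAlgHom, Bialgebra.comulAlgHom_apply]
    rw [AlgEquiv.symm_apply_apply, Ideal.Quotient.mkₐ_eq_mk, hΔ₀b]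
  exact ⟨_, key, fun Δ' hΔ' => algHom_localization_ext _ _ _ (hΔ'.trans key.symm)⟩

end UnitFactorLocalization

end Literature.RingTheory.Henselian

end
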